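import Mathlib
import Literature.MathematicalPhysics.QuantumFieldTheory.Balaban1983to89.B5Prop11Lattice
import Literature.MathematicalPhysics.QuantumFieldTheory.Balaban1983to89.B5Prop11G0Torus
import Literature.MathematicalPhysics.QuantumFieldTheory.Balaban1983to89.B5Cube1Partition
import Literature.MathematicalPhysics.QuantumFieldTheory.Balaban1983to89.B5SiteBridgeP12
import Literature.Analysis.Matrix.QuadraticCombesThomas

/-!
# `Balaban1983to89.B5CombesThomasLattice` — the «simplest proof» route of B5 p. 36 FOR `G = Δ_a⁻¹` ITSELF on the
# lattice torus of record (`B5DeltaA169.DeltaA n M a`): exponentially conjugated quadratic form of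
# `Δ_a = Δ − ∂P∂* + aQ*Q`, its coercivity from (1.90) and the printed kernel bound (1.126), and the weighted solves

statement-level skeleton of published theorems with citation tags; proofs where landed; nothing here is a claim
about the Yang–Mills mass gap

Source (lit-balaban cell, Phase-2 proof seat p37 gen 7): T. Bałaban, *Propagators and renormalization transformations
for lattice gauge theories. I*, Commun. Math. Phys. **95** (1984) 17–40 [`Balaban1984PropagatorsI`, "B5"], pp. 33, 36–39
[PDF 17, 20–23]; held as `paper:balaban1984-cmp95-propagators-rt-i` (OCR pages p0017, p0020–p0023 read this session).
Unit `lit-balaban-p37`, HOME `run/shared/lean/pub/lit-balaban/` (SKELETON row B5.Prop1.2, owner's census item (vi)-G).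

## WHAT IS PRINTED (verbatim)

p. 36 [PDF 20], after (1.117): «A proof of Proposition 1.2 will be given in several steps. In the first step we will
show that the inequalities (1.115)-(1.117), (1.89) imply the proposition. Probably the simplest proof of the exponential
decay properties can be obtained by relating G on the torus to G on the whole lattice ηZ^d in the usual way, and then
proving that the operator e^{−⟨q,x⟩}Δ_a e^{⟨q,x⟩} − Δ_a is a small perturbation of Δ_a for vectors q ∈ R^d sufficiently
small. Instead we construct a random walk representation of the kind described in [2].»
p. 33 [PDF 17], Prop. 1.1: «The operator G is a symmetric operator on L²(T_η) and … (1.89) … This implies the bound from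
below: Δ_a = G⁻¹ ≥ γ₀(Δ + I). (1.90)»
p. 37 [PDF 21], (1.120) (the kernel convention): «(∂P∂*hA)_μ(x) = Σ_{x′,ν} η^d(∂P∂*)_{μν}(x, x′)h(x′)A_ν(x′)».
p. 38 [PDF 22], (1.126): «|(∂P∂*)_{μ,ν}(x, x′)| ≤ O(1)e^{−δ′₀|x−x′|}, (1.126) … The constant O(1) in (1.126) depends on d
only».
p. 39 [PDF 23]: «Let us notice that the proof of inequalities (1.114), describing the decay in L²-norms, is completed
because we have proved inequalities (1.89).»

## WHAT THIS MODULE PROVES (kernel-checked, zero sorry) — the analytic core of the p. 36 route FOR `G`, run ON THE TORUS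

The objects are r02's matrix presentation of record (`B5Prop11Lattice`, `B5Prop12FieldsLattice`): the fine torus
`T_η = Tor (fine n M)` (`η = 1/n`), vector fields `ι = T_η × Fin d → ℂ`, `∇_ν = fdiff (fine n M) n ν`, `Δ = Lap n M`,
`Δ_a = DeltaA n M a = Δ − ∂P∂* + a•Q*Q` with `∂P∂* = dPd n M := GradOp·PcT·GradOpᴴ` and `Q*Q = QvAdj·QvOp`, unweighted
`ℓ²` masses `nsq` (both sides of (1.114) carry the same `η^{d/2}`).  We conjugate `Δ_a` by the multiplication operator
`E = e^{δρ}` for a real function `ρ` on `T_η` which is 1-Lipschitz for the distance in units `distU n M` (instance: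
`ρ = distU(·, n·y′)`, the scaled sup-distance to the corner of the cube `Δ̃(y′)`):
* §1 elementary exponential bounds; §2 the weights `wt δ ρ`, `wmul`, one fine step changes `ρ` by `≤ 1/n`, the fine-lattice
  exponential row sums `Σ_{x′} η^d e^{−κ|x−x′|} ≤ e^{2κ}K_d(κ)` uniformly in `η`, `T_η` (`fineRowSum_le`, through r02's unit
  cubes `cube1` and `B5RowSumsP12Lattice.rowSum_univ_distSite_le`);
* §3 CONJUGATED LAPLACIAN: the pointwise identity `conj(∇(Ew))·∇(E⁻¹w) = |∇w|² − n²(t + t⁻¹ − 2)·Re(w̄⁺w)` (`t = E⁺/E`) and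
  `Re⟨Ew, Δ(E⁻¹w)⟩ ≥ Σ_ν‖∇_νw‖² − 2dδ²‖w‖²` (`conjLap_ge`) — p38's identity for G₀ (`B5CombesThomasTorus`) in the complex
  presentation;
* §4 CONJUGATED AVERAGING: `|⟨Ew, Q*Q(E⁻¹w)⟩ − ⟨w, Q*Qw⟩| ≤ (e^{4δ} − 1)‖w‖²` (`conjQQ_sub_le`) by Schur's test from r02's
  `qent_rowsum`/`qent_colsum` and the support of `Q*Q` (two bonds on averaging segments of one coarse bond are `≤ 4` units
  apart, `distU_le_four_of_QQ_ne_zero`);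
* the companion module `B5CombesThomasLatticeSolve` continues with §7 the conjugated `∂P∂*` UNDER THE PRINTED BOUND (1.126)
  READ ON THE MATRIX OF RECORD `dPd = GradOp·PcT·GradOpᴴ` (hypothesis `h126`), §8 the coercivity of the conjugated form
  («small perturbation of Δ_a»), §9 the weighted solves, §10 the norms of the conjugated operators.

## HONEST SCOPE / DIVERGENCE

This is NOT the random-walk expansion (1.118)–(1.131) that the paper carries out («Instead we construct …»); it is the
alternative the same paragraph names for THIS operator `Δ_a`, adapted to the torus (Lipschitz weight `e^{δρ}` in place of
`e^{⟨q,x⟩}` on ηZ^d) — a DIVERGENCE OF METHOD, disclosed; the statement it serves, (1.114) for G, is typed elsewhere verbatim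
(`B5.Local114Fam`) and is unchanged.  Inputs: (1.90) PROVED in the tree (`B5Prop11Lattice.ineq190_form`), the averaging
bookkeeping of `B5Prop11G0Torus` (`qent_rowsum`, `qent_colsum`), and (1.126) as the HYPOTHESIS `h126` in printed form on the
matrix of record (its discharge from `B5DPD126Uniform.matrixP_decay_uniform` needs the identification of `PcT` with the
multiplier-model projection — r02's (1.132) memo, not done here).  Constants ours and explicit; the paper prints none.
CELL BOOK-KEEPING (lit-balaban): row B5.Prop1.2, census item (vi)-G (owner r02, referee ref-4); VALUE = the L² decay
mechanism for Bałaban's G = Δ_a⁻¹ on the torus, kernel-checked modulo the printed leaf (1.126) — NOT summit progress.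
-/

namespace Literature.MathematicalPhysics.QuantumFieldTheory.Balaban1983to89.B5CombesThomasLattice

open scoped BigOperators Matrix ComplexConjugate ComplexOrder Matrix.Norms.L2Operator
open Finset Complex Matrix
open Literature.MathematicalPhysics.QuantumFieldTheory.Balaban1983to89.B5Prop11Plancherel (Tor fine fdiff shiftM unitVec)
open Literature.MathematicalPhysics.QuantumFieldTheory.Balaban1983to89.B5Prop11Lower (Lap nsq nsq_nonneg
  star_dotProduct_self form_gram)
open Literature.MathematicalPhysics.QuantumFieldTheory.Balaban1983to89.B5Prop11Lattice (gammaZero gammaZero_pos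
  ineq190_form)
open Literature.MathematicalPhysics.QuantumFieldTheory.Balaban1983to89.B5Prop11G0Torus (form_Lap qent QvOp_eq_qent
  qent_rowsum qent_colsum)
open Literature.MathematicalPhysics.QuantumFieldTheory.Balaban1983to89.B5Prop12FieldsLattice (cdistF distU distSite
  toFine cube1 cubeT distU_nonneg distSite_nonneg toFine_mem_cubeT)
open Literature.MathematicalPhysics.QuantumFieldTheory.Balaban1983to89.B5DeltaA169 (DeltaA QvAdj)
open Literature.MathematicalPhysics.QuantumFieldTheory.Balaban1983to89.B5Block118 (QvOp bpt tstep)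
open Literature.MathematicalPhysics.QuantumFieldTheory.Balaban1983to89.B5Value126 (PcT)
open Literature.MathematicalPhysics.QuantumFieldTheory.Balaban1983to89.B5Action121 (GradOp)
open Literature.MathematicalPhysics.QuantumFieldTheory.Balaban1983to89.B5Cube1Partition (blockLabel mem_cube1_iff
  sum_ite_mem_cube1 card_cube1 cube1_subset_cubeT mem_cube1_blockLabel)
open Literature.MathematicalPhysics.QuantumFieldTheory.Balaban1983to89.B5RowSumsP12Lattice (rowSum_univ_distSite_le
  distSite_comm distSite_triangle)
open Literature.MathematicalPhysics.QuantumFieldTheory.Balaban1983to89.B5Carrier132CubeGeom (distSite_sub_two_le_distU)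
open Literature.MathematicalPhysics.QuantumFieldTheory.Balaban1983to89.B5CoverP12Lattice (distU_comm)
open Literature.MathematicalPhysics.QuantumFieldTheory.Balaban1983to89.B5SiteBridgeP12 (distU_eq_distSite_div
  mem_cubeT_iff distSite_fine_le_iff)
open Literature.MathematicalPhysics.QuantumFieldTheory.Balaban1983to89.B4Sect5Proof (latticeConst latticeConst_nonneg)

noncomputable section

variable {d : ℕ}

/-! ## §1 Elementary exponential bounds -/

/-- `|e^σ − 1| ≤ 2|σ|` for `|σ| ≤ 1`. [folklore] -/
private theorem abs_exp_sub_one_le {σ : ℝ} (h : |σ| ≤ 1) : |Real.exp σ - 1| ≤ 2 * |σ| := by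
  have h1 := Real.abs_exp_sub_one_sub_id_le h
  have h2 : |Real.exp σ - 1| ≤ |Real.exp σ - 1 - σ| + |σ| := by
    have := abs_add_le (Real.exp σ - 1 - σ) σ
    simpa using this
  have h3 : σ ^ 2 ≤ |σ| := by
    have h0 : 0 ≤ |σ| := abs_nonneg σ
    calc σ ^ 2 = |σ| * |σ| := by rw [← sq_abs]; ring
      _ ≤ |σ| * 1 := mul_le_mul_of_nonneg_left h h0
      _ = |σ| := mul_one _
  linarith

/-- `e^σ + e^{−σ} − 2 ≤ 2σ²` for `|σ| ≤ 1`. [folklore] -/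
private theorem exp_add_exp_neg_sub_two_le {σ : ℝ} (h : |σ| ≤ 1) : Real.exp σ + Real.exp (-σ) - 2 ≤ 2 * σ ^ 2 := by
  have h1 := Real.abs_exp_sub_one_sub_id_le h
  have h2 := Real.abs_exp_sub_one_sub_id_le (show |(-σ)| ≤ 1 by rwa [abs_neg])
  have e1 := (abs_le.mp h1).2
  have e2 := (abs_le.mp h2).2
  nlinarith

/-- `0 ≤ e^σ + e^{−σ} − 2`. [folklore] -/
private theorem exp_add_exp_neg_sub_two_nonneg (σ : ℝ) : 0 ≤ Real.exp σ + Real.exp (-σ) - 2 := by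
  have hprod : Real.exp σ * Real.exp (-σ) = 1 := by rw [← Real.exp_add, add_neg_cancel, Real.exp_zero]
  nlinarith [sq_nonneg (Real.exp σ - Real.exp (-σ)), Real.exp_pos (-σ), Real.exp_pos σ]

/-- `|e^σ − 1| ≤ e^{|σ|} − 1`. [folklore] -/
private theorem abs_exp_sub_one_le_exp_abs_sub_one (σ : ℝ) : |Real.exp σ - 1| ≤ Real.exp |σ| - 1 := by
  rcases le_or_gt 0 σ with h | h
  · rw [abs_of_nonneg h, abs_of_nonneg (by linarith [Real.add_one_le_exp σ, h])]
  · rw [abs_of_neg h, abs_of_nonpos (by linarith [Real.exp_le_one_iff.mpr h.le])]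
    have := exp_add_exp_neg_sub_two_nonneg σ
    linarith

/-! ## §2 Distances in units on the fine torus, the weights `e^{δρ}` -/

section Geometry

variable (n : ℕ) [NeZero n] (M : Fin d → ℕ) [hM : ∀ μ, NeZero (M μ)]

/-- `|x − x′|` in units satisfies the triangle inequality. [cite: Balaban1984PropagatorsI, (1.109) p.35 (|x − x′|)] -/
theorem distU_triangle (x w x' : Tor (fine n M)) : distU n M x x' ≤ distU n M x w + distU n M w x' := by
  rw [distU_eq_distSite_div, distU_eq_distSite_div, distU_eq_distSite_div, ← add_div]
  have hn : (0 : ℝ) < n := by exact_mod_cast Nat.pos_of_ne_zero (NeZero.ne n)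
  exact div_le_div_of_nonneg_right (distSite_triangle (fine n M) x w x') hn.le

omit [NeZero n] hM in
/-- `|valMinAbs (m : ℤ/N)| ≤ m` for a natural number `m`. [folklore] -/
private theorem natAbs_valMinAbs_natCast_le (N m : ℕ) [NeZero N] : ((m : ZMod N).valMinAbs).natAbs ≤ m := by
  rw [ZMod.valMinAbs_natAbs_eq_min, ZMod.val_natCast]
  exact (min_le_left _ _).trans (Nat.mod_le m N)

/-- one fine step has length `η = 1/n` in units: `|x − (x + e_ν)| ≤ 1/n`. [cite: Balaban1984PropagatorsI, p.35 (T_η, η = L^{−k})] -/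
theorem distU_step_le (x : Tor (fine n M)) (ν : Fin d) : distU n M x (x + unitVec (fine n M) ν) ≤ 1 / n := by
  rw [distU_eq_distSite_div]
  have hn : (0 : ℝ) < n := by exact_mod_cast Nat.pos_of_ne_zero (NeZero.ne n)
  refine div_le_div_of_nonneg_right ?_ hn.le
  unfold distSite
  have h : (Finset.univ.sup fun μ => ((x μ - (x + unitVec (fine n M) ν) μ).valMinAbs).natAbs) ≤ 1 := by
    refine Finset.sup_le fun μ _ => ?_
    have e : x μ - (x + unitVec (fine n M) ν) μ = -(unitVec (fine n M) ν μ) := by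
      simp only [Pi.add_apply]; ring
    rw [e, ZMod.natAbs_valMinAbs_neg]
    unfold unitVec
    by_cases hμ : μ = ν
    · subst hμ
      rw [Pi.single_eq_same]
      have := natAbs_valMinAbs_natCast_le (fine n M μ) 1
      simpa using this
    · rw [Pi.single_eq_of_ne hμ, ZMod.valMinAbs_zero]; simp
  exact_mod_cast h

/-- on `Δ̃(y′)`: `|x − n·y′| ≤ 1`. [cite: Balaban1984PropagatorsI, p.35 (the cubes Δ̃(y))] -/
theorem distU_toFine_le_one_of_mem_cubeT {x : Tor (fine n M)} {y : Tor M} (hx : x ∈ cubeT n M y) :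
    distU n M x (toFine n M y) ≤ 1 := by
  rw [distU_eq_distSite_div]
  have hn : (0 : ℝ) < n := by exact_mod_cast Nat.pos_of_ne_zero (NeZero.ne n)
  rw [div_le_one hn]
  exact (distSite_fine_le_iff n M x (toFine n M y)).mpr ((mem_cubeT_iff n M x y).mp hx)

/-- `n·y ∈ Δ(y)` (the corner is in its unit cube). [cite: Balaban1984PropagatorsI, p.35 (Δ(y) = B^k(y))] -/
theorem toFine_mem_cube1 (hn : 1 ≤ n) (y : Tor M) : toFine n M y ∈ cube1 n M y := by
  rw [mem_cube1_iff]
  funext μ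
  apply ZMod.val_injective
  rw [B5Cube1Partition.blockLabel_val, B5SiteBridgeP12.toFine_val]
  rw [Nat.mul_div_cancel_left _ (by omega)]

/-- for `x ∈ Δ̃(y)`: `|y − y′| − 2 ≤ |x − n·y′|` (the distance in units from `Δ̃(y)` to the corner of `Δ̃(y′)`).
[cite: Balaban1984PropagatorsI, Prop. 1.2 p.35 (supp ζ ⊂ Δ̃(y), supp J ⊂ Δ̃(y′), e^{−δ₀|y−y′|})] -/
theorem distSite_sub_two_le_distU_toFine (hn : 1 ≤ n) {x : Tor (fine n M)} {y : Tor M} (hx : x ∈ cubeT n M y) (y' : Tor M) :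
    distSite M y y' - 2 ≤ distU n M x (toFine n M y') := by
  have h := distSite_sub_two_le_distU M n hn (toFine_mem_cube1 n M hn y') hx
  rw [distSite_comm, distU_comm] at h
  exact h

/-- **THE FINE-LATTICE EXPONENTIAL ROW SUMS, UNIFORM IN `η` AND THE TORUS**: `Σ_{x′∈T_η} η^d e^{−κ|x−x′|} ≤ e^{2κ}K_d(κ)`
(unit blocks of `n^d` fine points, the unit-lattice row sums `B5RowSumsP12Lattice.rowSum_univ_distSite_le`).
[cite: Balaban1984PropagatorsI, (1.131) p.38 (the summation Σ_{x∈Z^d} e^{−δ₀M₀|x|}); proof ours] -/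
theorem fineRowSum_le (hn : 1 ≤ n) {κ : ℝ} (hκ : 0 < κ) (x : Tor (fine n M)) :
    ∑ x' : Tor (fine n M), ((n : ℝ) ^ d)⁻¹ * Real.exp (-(κ * distU n M x x'))
      ≤ Real.exp (2 * κ) * latticeConst d κ := by
  have hn0 : (0 : ℝ) < (n : ℝ) ^ d := by positivity
  -- bound each term by the block of x'
  have hpt : ∀ x' : Tor (fine n M), ((n : ℝ) ^ d)⁻¹ * Real.exp (-(κ * distU n M x x'))
      ≤ ∑ y' : Tor M, if x' ∈ cube1 n M y' then
          ((n : ℝ) ^ d)⁻¹ * (Real.exp (2 * κ) * Real.exp (-(κ * distSite M (blockLabel M n x) y'))) else 0 := by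
    intro x'
    rw [sum_ite_mem_cube1]
    refine mul_le_mul_of_nonneg_left ?_ (by positivity)
    rw [← Real.exp_add]
    apply Real.exp_le_exp.mpr
    have h := distSite_sub_two_le_distU M n hn (mem_cube1_blockLabel M n x)
      (cube1_subset_cubeT M n hn _ (mem_cube1_blockLabel M n x'))
    nlinarith
  refine (Finset.sum_le_sum fun x' _ => hpt x').trans ?_
  rw [Finset.sum_comm]
  have hblock : ∀ y' : Tor M, (∑ x' : Tor (fine n M), if x' ∈ cube1 n M y' then
      ((n : ℝ) ^ d)⁻¹ * (Real.exp (2 * κ) * Real.exp (-(κ * distSite M (blockLabel M n x) y'))) else 0)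
      = Real.exp (2 * κ) * Real.exp (-(κ * distSite M (blockLabel M n x) y')) := by
    intro y'
    rw [← Finset.sum_filter, Finset.sum_const]
    have hc : (Finset.univ.filter fun x' : Tor (fine n M) => x' ∈ cube1 n M y') = cube1 n M y' := by
      ext x'; simp
    rw [hc, card_cube1, nsmul_eq_mul]
    push_cast
    field_simp
  simp only [hblock, ← Finset.mul_sum]
  exact mul_le_mul_of_nonneg_left (rowSum_univ_distSite_le M hκ _) (by positivity)

/-- **the distance to the corner of `Δ̃(y′)`**, `ρ_{y′}(x) = |x − n·y′|` in units — the Lipschitz function in the weight.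
[cite: Balaban1984PropagatorsI, p.36 (e^{⟨q,x⟩}; here the torus substitute)] -/
def rho (y' : Tor M) (x : Tor (fine n M)) : ℝ := distU n M x (toFine n M y')

/-- `ρ` is 1-Lipschitz for `|x − x′|`. [cite: Balaban1984PropagatorsI, p.36 (the weight)] -/
theorem abs_rho_sub_rho_le (y' : Tor M) (x x' : Tor (fine n M)) :
    |rho n M y' x - rho n M y' x'| ≤ distU n M x x' := by
  unfold rho
  rw [abs_sub_le_iff]
  constructor
  · have := distU_triangle n M x x' (toFine n M y'); linarith
  · have := distU_triangle n M x' x (toFine n M y'); rw [distU_comm M n x' x] at this; linarith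

omit [NeZero n] hM in
/-- `0 ≤ ρ`. [cite: Balaban1984PropagatorsI, p.36 (the weight)] -/
theorem rho_nonneg (y' : Tor M) (x : Tor (fine n M)) : 0 ≤ rho n M y' x := distU_nonneg _ _

/-- on the support cube: `ρ_{y′} ≤ 1` on `Δ̃(y′)`. [cite: Balaban1984PropagatorsI, Prop. 1.2 p.35 (supp J ⊂ Δ̃(y′))] -/
theorem rho_le_one_of_mem_cubeT {x : Tor (fine n M)} {y' : Tor M} (hx : x ∈ cubeT n M y') : rho n M y' x ≤ 1 :=
  distU_toFine_le_one_of_mem_cubeT n M hx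

/-- on the observation cube: `|y − y′| − 2 ≤ ρ_{y′}` on `Δ̃(y)`. [cite: Balaban1984PropagatorsI, Prop. 1.2 p.35 (e^{−δ₀|y−y′|})] -/
theorem distSite_sub_two_le_rho (hn : 1 ≤ n) {x : Tor (fine n M)} {y : Tor M} (hx : x ∈ cubeT n M y) (y' : Tor M) :
    distSite M y y' - 2 ≤ rho n M y' x :=
  distSite_sub_two_le_distU_toFine n M hn hx y'

end Geometry

/-! ## §3 The weights `E = e^{δρ}` and the pointwise difference calculus -/

section Weights

variable (n : ℕ) [NeZero n] (M : Fin d → ℕ) [hM : ∀ μ, NeZero (M μ)]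

/-- the weight `E(x) = e^{δρ(x)}`. [cite: Balaban1984PropagatorsI, p.36 (e^{⟨q,x⟩})] -/
def wt (δ : ℝ) (ρ : Tor (fine n M) → ℝ) (x : Tor (fine n M)) : ℝ := Real.exp (δ * ρ x)

/-- multiplication of a vector field by a real function of the site: `(E·v)_μ(x) = E(x)v_μ(x)`.
[cite: Balaban1984PropagatorsI, p.36 (e^{⟨q,x⟩}Δ_a e^{−⟨q,x⟩})] -/
def wmul (E : Tor (fine n M) → ℝ) (v : Tor (fine n M) × Fin d → ℂ) : Tor (fine n M) × Fin d → ℂ :=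
  fun i => (E i.1 : ℂ) * v i

omit [NeZero n] hM in
/-- `E > 0`. [cite: Balaban1984PropagatorsI, p.36 (the weight)] -/
theorem wt_pos (δ : ℝ) (ρ : Tor (fine n M) → ℝ) (x : Tor (fine n M)) : 0 < wt n M δ ρ x := Real.exp_pos _

omit [NeZero n] hM in
/-- `e^{−δρ} = (e^{δρ})⁻¹`. [cite: Balaban1984PropagatorsI, p.36 (the weight)] -/
theorem wt_neg (δ : ℝ) (ρ : Tor (fine n M) → ℝ) (x : Tor (fine n M)) : wt n M (-δ) ρ x = (wt n M δ ρ x)⁻¹ := by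
  rw [wt, wt, ← Real.exp_neg]; ring_nf

omit [NeZero n] hM in
/-- unfolding of `wmul`. [cite: Balaban1984PropagatorsI, p.36 (the weight)] -/
@[simp] theorem wmul_apply (E : Tor (fine n M) → ℝ) (v : Tor (fine n M) × Fin d → ℂ) (i : Tor (fine n M) × Fin d) :
    wmul n M E v i = (E i.1 : ℂ) * v i := rfl

omit [NeZero n] hM in
/-- `e^{−δρ}·(e^{δρ}·v) = v`. [cite: Balaban1984PropagatorsI, p.36 (the weight)] -/
theorem wmul_neg_wmul (δ : ℝ) (ρ : Tor (fine n M) → ℝ) (v : Tor (fine n M) × Fin d → ℂ) :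
    wmul n M (wt n M (-δ) ρ) (wmul n M (wt n M δ ρ) v) = v := by
  funext i
  simp only [wmul_apply, wt_neg, ← mul_assoc]
  rw [← Complex.ofReal_mul, inv_mul_cancel₀ (wt_pos n M δ ρ i.1).ne', Complex.ofReal_one, one_mul]

omit [NeZero n] hM in
/-- `e^{δρ}·(e^{−δρ}·v) = v`. [cite: Balaban1984PropagatorsI, p.36 (the weight)] -/
theorem wmul_wmul_neg (δ : ℝ) (ρ : Tor (fine n M) → ℝ) (v : Tor (fine n M) × Fin d → ℂ) :
    wmul n M (wt n M δ ρ) (wmul n M (wt n M (-δ) ρ) v) = v := by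
  have h := wmul_neg_wmul n M (-δ) ρ v
  rwa [neg_neg] at h

omit [NeZero n] hM in
/-- the ratio of the weight at two points: `E(x′) = e^{δ(ρ(x′) − ρ(x))}E(x)`. [cite: Balaban1984PropagatorsI, p.36 (the weight)] -/
theorem wt_eq_exp_mul (δ : ℝ) (ρ : Tor (fine n M) → ℝ) (x x' : Tor (fine n M)) :
    wt n M δ ρ x' = Real.exp (δ * (ρ x' - ρ x)) * wt n M δ ρ x := by
  rw [wt, wt, ← Real.exp_add]; ring_nf

omit [NeZero n] hM in
/-- `‖wmul E v i‖ = E(i)‖v i‖` for `E > 0`. [cite: Balaban1984PropagatorsI, p.36 (the weight)] -/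
theorem norm_wmul_wt (δ : ℝ) (ρ : Tor (fine n M) → ℝ) (v : Tor (fine n M) × Fin d → ℂ) (i : Tor (fine n M) × Fin d) :
    ‖wmul n M (wt n M δ ρ) v i‖ = wt n M δ ρ i.1 * ‖v i‖ := by
  rw [wmul_apply, norm_mul, Complex.norm_real, Real.norm_of_nonneg (wt_pos n M δ ρ i.1).le]

/-- the forward neighbour bond `(x + e_ν, μ)`. [cite: Balaban1984PropagatorsI, (1.31) p.23] -/
def nb (ν : Fin d) (i : Tor (fine n M) × Fin d) : Tor (fine n M) × Fin d := (i.1 + unitVec (fine n M) ν, i.2)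

/-- `(∇_ν u)_μ(x) = c·(u_μ(x + e_ν) − u_μ(x))`. [cite: Balaban1984PropagatorsI, (1.31) p.23] -/
theorem fdiff_apply (c : ℂ) (ν : Fin d) (u : Tor (fine n M) × Fin d → ℂ) (i : Tor (fine n M) × Fin d) :
    (fdiff (fine n M) c ν *ᵥ u) i = c * (u (nb n M ν i) - u i) := by
  obtain ⟨x, κ⟩ := i
  rw [fdiff, Matrix.smul_mulVec, Pi.smul_apply, Matrix.sub_mulVec, Pi.sub_apply, B5Action121.shiftM_mulVec,
    Matrix.one_mulVec, smul_eq_mul]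
  rfl

/-- adjointness `⟨u, X^* w⟩ = ⟨X u, w⟩` for the (unweighted) scalar product — `∂*`, `∇_ν^*` are the adjoints of `∂`, `∇_ν`.
[cite: Balaban1984PropagatorsI, (1.21) p.21 (the scalar products and the divergence ∂* as the adjoint of ∂)] -/
theorem star_dotProduct_conjTranspose_mulVec (X : Matrix (Tor (fine n M) × Fin d) (Tor (fine n M) × Fin d) ℂ)
    (u w : Tor (fine n M) × Fin d → ℂ) : star u ⬝ᵥ (Xᴴ *ᵥ w) = star (X *ᵥ u) ⬝ᵥ w := by
  rw [Matrix.dotProduct_mulVec, Matrix.vecMul_conjTranspose, star_star]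

/-- translation invariance of the `ℓ²` mass: `Σ_i ‖w(i⁺)‖² = Σ_i ‖w(i)‖²`. [folklore] -/
private theorem sum_norm_sq_nb (ν : Fin d) (w : Tor (fine n M) × Fin d → ℂ) :
    ∑ i, ‖w (nb n M ν i)‖ ^ 2 = ∑ i, ‖w i‖ ^ 2 := by
  let e : Tor (fine n M) × Fin d ≃ Tor (fine n M) × Fin d :=
    (Equiv.addRight (unitVec (fine n M) ν)).prodCongr (Equiv.refl _)
  exact Fintype.sum_equiv e (fun i => ‖w (nb n M ν i)‖ ^ 2) (fun i => ‖w i‖ ^ 2) (fun i => rfl)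

/-- the one-step ratio exponent `σ = δ(ρ(x+e_ν) − ρ(x))` has `|σ| ≤ |δ|/n ≤ |δ|` for a 1-Lipschitz `ρ`.
[cite: Balaban1984PropagatorsI, p.36 (q sufficiently small)] -/
theorem abs_step_le {ρ : Tor (fine n M) → ℝ} (hρ : ∀ x x', |ρ x - ρ x'| ≤ distU n M x x') (δ : ℝ)
    (x : Tor (fine n M)) (ν : Fin d) :
    |δ * (ρ (x + unitVec (fine n M) ν) - ρ x)| ≤ |δ| / n := by
  rw [abs_mul]
  have h1 : |ρ (x + unitVec (fine n M) ν) - ρ x| ≤ 1 / n := by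
    have := hρ (x + unitVec (fine n M) ν) x
    rw [distU_comm] at this
    exact this.trans (distU_step_le n M x ν)
  calc |δ| * |ρ (x + unitVec (fine n M) ν) - ρ x| ≤ |δ| * (1 / n) := mul_le_mul_of_nonneg_left h1 (abs_nonneg δ)
    _ = |δ| / n := by ring

/-- … hence `n·|σ| ≤ |δ|` and `|σ| ≤ 1` when `|δ| ≤ 1`. [cite: Balaban1984PropagatorsI, p.36 (q sufficiently small)] -/
theorem abs_step_le_one {ρ : Tor (fine n M) → ℝ} (hρ : ∀ x x', |ρ x - ρ x'| ≤ distU n M x x') {δ : ℝ} (hδ : |δ| ≤ 1)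
    (x : Tor (fine n M)) (ν : Fin d) :
    |δ * (ρ (x + unitVec (fine n M) ν) - ρ x)| ≤ 1 := by
  refine (abs_step_le n M hρ δ x ν).trans ?_
  have hn : (1 : ℝ) ≤ n := by exact_mod_cast Nat.one_le_iff_ne_zero.mpr (NeZero.ne n)
  calc |δ| / n ≤ |δ| / 1 := div_le_div_of_nonneg_left (abs_nonneg δ) one_pos hn
    _ ≤ 1 := by rw [div_one]; exact hδ

/-- **PRODUCT RULE**: `∇_ν(E·u)(x) = E(x+e_ν)·(∇_νu)(x) + n(E(x+e_ν) − E(x))·u(x)`.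
[cite: Balaban1984PropagatorsI, (1.120)–(1.121) p.37 (the commutator of Δ_a with a multiplication operator)] -/
theorem fdiff_wmul (E : Tor (fine n M) → ℝ) (u : Tor (fine n M) × Fin d → ℂ) (ν : Fin d) (i : Tor (fine n M) × Fin d) :
    (fdiff (fine n M) (n : ℂ) ν *ᵥ wmul n M E u) i
      = (E (nb n M ν i).1 : ℂ) * (fdiff (fine n M) (n : ℂ) ν *ᵥ u) i
        + ((n : ℝ) * (E (nb n M ν i).1 - E i.1) : ℝ) * u i := by
  rw [fdiff_apply, fdiff_apply, wmul_apply, wmul_apply]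
  push_cast
  ring

/-- the coefficient of the product rule: `n|E(x+e_ν) − E(x)| ≤ 2|δ|·E(x)` for `E = e^{δρ}`, `ρ` 1-Lipschitz, `|δ| ≤ 1`.
[cite: Balaban1984PropagatorsI, p.36 (q sufficiently small)] -/
theorem mul_abs_wt_sub_le {ρ : Tor (fine n M) → ℝ} (hρ : ∀ x x', |ρ x - ρ x'| ≤ distU n M x x') {δ : ℝ} (hδ : |δ| ≤ 1)
    (x : Tor (fine n M)) (ν : Fin d) :
    (n : ℝ) * |wt n M δ ρ (x + unitVec (fine n M) ν) - wt n M δ ρ x| ≤ 2 * |δ| * wt n M δ ρ x := by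
  have hn : (0 : ℝ) < n := by exact_mod_cast Nat.pos_of_ne_zero (NeZero.ne n)
  have h2 := abs_exp_sub_one_le (abs_step_le_one n M hρ hδ x ν)
  have h3 := abs_step_le n M hρ δ x ν
  have h1 := wt_eq_exp_mul n M δ ρ x (x + unitVec (fine n M) ν)
  generalize δ * (ρ (x + unitVec (fine n M) ν) - ρ x) = σ at h1 h2 h3
  have h4 : wt n M δ ρ (x + unitVec (fine n M) ν) - wt n M δ ρ x = (Real.exp σ - 1) * wt n M δ ρ x := by
    rw [h1]; ring
  rw [h4, abs_mul, abs_of_pos (wt_pos n M δ ρ x)]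
  have hw := (wt_pos n M δ ρ x).le
  calc (n : ℝ) * (|Real.exp σ - 1| * wt n M δ ρ x) = ((n : ℝ) * |Real.exp σ - 1|) * wt n M δ ρ x := by ring
    _ ≤ (2 * |δ|) * wt n M δ ρ x := by
        refine mul_le_mul_of_nonneg_right ?_ hw
        calc (n : ℝ) * |Real.exp σ - 1| ≤ (n : ℝ) * (2 * (|δ| / n)) :=
              mul_le_mul_of_nonneg_left (h2.trans (by linarith)) hn.le
          _ = 2 * |δ| := by field_simp
    _ = 2 * |δ| * wt n M δ ρ x := by ring

/-- the weight one step away: `E(x+e_ν) ≤ e^{|δ|/n}E(x) ≤ 3E(x)` (`|δ| ≤ 1`). [cite: Balaban1984PropagatorsI, p.36 (the weight)] -/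
theorem wt_nb_le {ρ : Tor (fine n M) → ℝ} (hρ : ∀ x x', |ρ x - ρ x'| ≤ distU n M x x') {δ : ℝ} (hδ : |δ| ≤ 1)
    (x : Tor (fine n M)) (ν : Fin d) :
    wt n M δ ρ (x + unitVec (fine n M) ν) ≤ 3 * wt n M δ ρ x := by
  rw [wt_eq_exp_mul n M δ ρ x (x + unitVec (fine n M) ν)]
  refine mul_le_mul_of_nonneg_right ?_ (wt_pos n M δ ρ x).le
  have h := abs_step_le_one n M hρ hδ x ν
  have h1 : δ * (ρ (x + unitVec (fine n M) ν) - ρ x) ≤ 1 := (le_abs_self _).trans h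
  calc Real.exp (δ * (ρ (x + unitVec (fine n M) ν) - ρ x)) ≤ Real.exp 1 := Real.exp_le_exp.mpr h1
    _ ≤ 3 := by have := Real.exp_one_lt_d9; linarith

end Weights

/-! ## §4 The conjugated Laplacian: p38's pointwise identity in the complex presentation -/

section ConjLap

variable (n : ℕ) [NeZero n] (M : Fin d → ℕ) [hM : ∀ μ, NeZero (M μ)]

/-- pure algebra: `Re[conj(c(E₁b − E₀a))·c(E₁⁻¹b − E₀⁻¹a)] = |c(b − a)|² − c²(E₁/E₀ + E₀/E₁ − 2)·Re(b̄a)`. [folklore] -/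
private theorem re_conj_mul_weighted (a b : ℂ) (c E₀ E₁ : ℝ) (h0 : E₀ ≠ 0) (h1 : E₁ ≠ 0) :
    (conj ((c : ℂ) * ((E₁ : ℂ) * b - (E₀ : ℂ) * a)) * ((c : ℂ) * (((E₁⁻¹ : ℝ) : ℂ) * b - ((E₀⁻¹ : ℝ) : ℂ) * a))).re
      = ‖(c : ℂ) * (b - a)‖ ^ 2 - c ^ 2 * (E₁ / E₀ + E₀ / E₁ - 2) * (conj b * a).re := by
  simp only [Complex.mul_re, Complex.mul_im, Complex.sub_re, Complex.sub_im, Complex.conj_re, Complex.conj_im,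
    Complex.ofReal_re, Complex.ofReal_im, Complex.sq_norm, Complex.normSq_apply]
  field_simp
  ring

/-- **THE POINTWISE IDENTITY** (p38's `B5CombesThomasTorus` §3 in the complex presentation): for `E > 0`,
`Re[conj(∇_ν(Ew))(i)·∇_ν(E⁻¹w)(i)] = |∇_νw(i)|² − n²(t + t⁻¹ − 2)·Re(conj(w(i⁺))w(i))`, `t = E(i⁺)/E(i)`.
[cite: Balaban1984PropagatorsI, p.36 («e^{−⟨q,x⟩}Δ_a e^{⟨q,x⟩} − Δ_a is a small perturbation»); identity ours] -/
theorem re_conj_fdiff_wmul (δ : ℝ) (ρ : Tor (fine n M) → ℝ) (w : Tor (fine n M) × Fin d → ℂ) (ν : Fin d)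
    (i : Tor (fine n M) × Fin d) :
    (conj ((fdiff (fine n M) (n : ℂ) ν *ᵥ wmul n M (wt n M δ ρ) w) i)
        * (fdiff (fine n M) (n : ℂ) ν *ᵥ wmul n M (wt n M (-δ) ρ) w) i).re
      = ‖(fdiff (fine n M) (n : ℂ) ν *ᵥ w) i‖ ^ 2
        - (n : ℝ) ^ 2 * (wt n M δ ρ (nb n M ν i).1 / wt n M δ ρ i.1 + wt n M δ ρ i.1 / wt n M δ ρ (nb n M ν i).1 - 2)
          * (conj (w (nb n M ν i)) * w i).re := by
  have hc : (n : ℂ) = ((n : ℝ) : ℂ) := by norm_cast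
  rw [fdiff_apply, fdiff_apply, fdiff_apply, wmul_apply, wmul_apply, wmul_apply, wmul_apply, wt_neg, wt_neg, hc]
  exact re_conj_mul_weighted (w i) (w (nb n M ν i)) (n : ℝ) _ _ (wt_pos n M δ ρ i.1).ne' (wt_pos n M δ ρ _).ne'

/-- the factor `n²(t + t⁻¹ − 2)` is between `0` and `2δ²` (`t = e^σ`, `|σ| ≤ |δ|/n`, `|δ| ≤ 1`).
[cite: Balaban1984PropagatorsI, p.36 (q sufficiently small)] -/
theorem ratio_factor_bounds {ρ : Tor (fine n M) → ℝ} (hρ : ∀ x x', |ρ x - ρ x'| ≤ distU n M x x') {δ : ℝ} (hδ : |δ| ≤ 1)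
    (x : Tor (fine n M)) (ν : Fin d) :
    0 ≤ (n : ℝ) ^ 2 * (wt n M δ ρ (x + unitVec (fine n M) ν) / wt n M δ ρ x
        + wt n M δ ρ x / wt n M δ ρ (x + unitVec (fine n M) ν) - 2) ∧
    (n : ℝ) ^ 2 * (wt n M δ ρ (x + unitVec (fine n M) ν) / wt n M δ ρ x
        + wt n M δ ρ x / wt n M δ ρ (x + unitVec (fine n M) ν) - 2) ≤ 2 * δ ^ 2 := by
  have hw := wt_pos n M δ ρ x
  have hw' := wt_pos n M δ ρ (x + unitVec (fine n M) ν)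
  have hn : (0 : ℝ) < n := by exact_mod_cast Nat.pos_of_ne_zero (NeZero.ne n)
  have hs1 : |δ * (ρ (x + unitVec (fine n M) ν) - ρ x)| ≤ 1 := abs_step_le_one n M hρ hδ x ν
  have hs2 : |δ * (ρ (x + unitVec (fine n M) ν) - ρ x)| ≤ |δ| / n := abs_step_le n M hρ δ x ν
  have hrat := wt_eq_exp_mul n M δ ρ x (x + unitVec (fine n M) ν)
  generalize δ * (ρ (x + unitVec (fine n M) ν) - ρ x) = σ at hs1 hs2 hrat
  have ht : wt n M δ ρ (x + unitVec (fine n M) ν) / wt n M δ ρ x = Real.exp σ := by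
    rw [hrat, mul_div_assoc, div_self hw.ne', mul_one]
  have ht' : wt n M δ ρ x / wt n M δ ρ (x + unitVec (fine n M) ν) = Real.exp (-σ) := by
    rw [hrat, Real.exp_neg]
    field_simp
  rw [ht, ht']
  refine ⟨mul_nonneg (by positivity) (exp_add_exp_neg_sub_two_nonneg σ), ?_⟩
  have h3 := exp_add_exp_neg_sub_two_le hs1
  have h4 : (n : ℝ) ^ 2 * σ ^ 2 ≤ δ ^ 2 := by
    have h5 : (n : ℝ) * |σ| ≤ |δ| := by
      have := mul_le_mul_of_nonneg_left hs2 hn.le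
      rwa [mul_div_cancel₀ _ hn.ne'] at this
    have h6 : 0 ≤ (n : ℝ) * |σ| := by positivity
    calc (n : ℝ) ^ 2 * σ ^ 2 = ((n : ℝ) * |σ|) ^ 2 := by rw [mul_pow, sq_abs]
      _ ≤ |δ| ^ 2 := pow_le_pow_left₀ h6 h5 2
      _ = δ ^ 2 := sq_abs δ
  calc (n : ℝ) ^ 2 * (Real.exp σ + Real.exp (-σ) - 2) ≤ (n : ℝ) ^ 2 * (2 * σ ^ 2) :=
        mul_le_mul_of_nonneg_left h3 (by positivity)
    _ = 2 * ((n : ℝ) ^ 2 * σ ^ 2) := by ring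
    _ ≤ 2 * δ ^ 2 := by linarith

/-- **CONJUGATED GRADIENT, one direction**: `Re⟨∇_ν(Ew), ∇_ν(E⁻¹w)⟩ ≥ ‖∇_νw‖² − 2δ²‖w‖²`.
[cite: Balaban1984PropagatorsI, p.36 («small perturbation of Δ_a»); proof ours (p38's route)] -/
theorem re_conj_fdiff_ge {ρ : Tor (fine n M) → ℝ} (hρ : ∀ x x', |ρ x - ρ x'| ≤ distU n M x x') {δ : ℝ} (hδ : |δ| ≤ 1)
    (w : Tor (fine n M) × Fin d → ℂ) (ν : Fin d) :
    nsq (fdiff (fine n M) (n : ℂ) ν *ᵥ w) - 2 * δ ^ 2 * nsq w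
      ≤ (star (fdiff (fine n M) (n : ℂ) ν *ᵥ wmul n M (wt n M δ ρ) w)
          ⬝ᵥ (fdiff (fine n M) (n : ℂ) ν *ᵥ wmul n M (wt n M (-δ) ρ) w)).re := by
  rw [dotProduct, Complex.re_sum]
  simp only [Pi.star_apply, Complex.star_def, re_conj_fdiff_wmul]
  rw [Finset.sum_sub_distrib]
  unfold nsq
  have hterm : ∀ i : Tor (fine n M) × Fin d,
      (n : ℝ) ^ 2 * (wt n M δ ρ (nb n M ν i).1 / wt n M δ ρ i.1 + wt n M δ ρ i.1 / wt n M δ ρ (nb n M ν i).1 - 2)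
          * (conj (w (nb n M ν i)) * w i).re
        ≤ δ ^ 2 * (‖w i‖ ^ 2 + ‖w (nb n M ν i)‖ ^ 2) := by
    intro i
    obtain ⟨h0, h2⟩ := ratio_factor_bounds n M hρ hδ i.1 ν
    have hre : (conj (w (nb n M ν i)) * w i).re ≤ ‖w (nb n M ν i)‖ * ‖w i‖ := by
      calc (conj (w (nb n M ν i)) * w i).re ≤ ‖conj (w (nb n M ν i)) * w i‖ := Complex.re_le_norm _
        _ = ‖w (nb n M ν i)‖ * ‖w i‖ := by rw [norm_mul, Complex.norm_conj]
    have hamgm : ‖w (nb n M ν i)‖ * ‖w i‖ ≤ (‖w i‖ ^ 2 + ‖w (nb n M ν i)‖ ^ 2) / 2 := by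
      nlinarith [sq_nonneg (‖w (nb n M ν i)‖ - ‖w i‖)]
    calc _ ≤ (n : ℝ) ^ 2 * (wt n M δ ρ (nb n M ν i).1 / wt n M δ ρ i.1
              + wt n M δ ρ i.1 / wt n M δ ρ (nb n M ν i).1 - 2) * (‖w (nb n M ν i)‖ * ‖w i‖) :=
          mul_le_mul_of_nonneg_left hre h0
      _ ≤ (2 * δ ^ 2) * ((‖w i‖ ^ 2 + ‖w (nb n M ν i)‖ ^ 2) / 2) :=
          mul_le_mul h2 hamgm (by positivity) (by positivity)
      _ = δ ^ 2 * (‖w i‖ ^ 2 + ‖w (nb n M ν i)‖ ^ 2) := by ring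
  have hsum : ∑ i : Tor (fine n M) × Fin d,
      (n : ℝ) ^ 2 * (wt n M δ ρ (nb n M ν i).1 / wt n M δ ρ i.1 + wt n M δ ρ i.1 / wt n M δ ρ (nb n M ν i).1 - 2)
          * (conj (w (nb n M ν i)) * w i).re
        ≤ 2 * δ ^ 2 * ∑ i : Tor (fine n M) × Fin d, ‖w i‖ ^ 2 := by
    refine (Finset.sum_le_sum fun i _ => hterm i).trans ?_
    rw [← Finset.mul_sum, Finset.sum_add_distrib, sum_norm_sq_nb]
    ring_nf
    rfl
  linarith

/-- **CONJUGATED LAPLACIAN**: `Re⟨Ew, Δ(E⁻¹w)⟩ ≥ Σ_ν‖∇_νw‖² − 2dδ²‖w‖²` for `E = e^{δρ}`, `ρ` 1-Lipschitz in units,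
`|δ| ≤ 1` — the first-order terms cancel identically, the perturbation is `O(δ²)`.
[cite: Balaban1984PropagatorsI, p.36 («e^{−⟨q,x⟩}Δ_a e^{⟨q,x⟩} − Δ_a is a small perturbation of Δ_a»); proof ours] -/
theorem conjLap_ge {ρ : Tor (fine n M) → ℝ} (hρ : ∀ x x', |ρ x - ρ x'| ≤ distU n M x x') {δ : ℝ} (hδ : |δ| ≤ 1)
    (w : Tor (fine n M) × Fin d → ℂ) :
    ∑ ν, nsq (fdiff (fine n M) (n : ℂ) ν *ᵥ w) - 2 * d * δ ^ 2 * nsq w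
      ≤ (star (wmul n M (wt n M δ ρ) w) ⬝ᵥ (Lap n M *ᵥ wmul n M (wt n M (-δ) ρ) w)).re := by
  have hL : Lap n M *ᵥ wmul n M (wt n M (-δ) ρ) w
      = ∑ ν, (fdiff (fine n M) (n : ℂ) ν)ᴴ *ᵥ (fdiff (fine n M) (n : ℂ) ν *ᵥ wmul n M (wt n M (-δ) ρ) w) := by
    rw [Lap, Matrix.sum_mulVec]
    refine Finset.sum_congr rfl fun ν _ => ?_
    rw [Matrix.mulVec_mulVec]
  rw [hL, dotProduct_sum, Complex.re_sum]
  have h := fun ν => re_conj_fdiff_ge n M hρ hδ w ν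
  calc ∑ ν, nsq (fdiff (fine n M) (n : ℂ) ν *ᵥ w) - 2 * d * δ ^ 2 * nsq w
      = ∑ ν : Fin d, (nsq (fdiff (fine n M) (n : ℂ) ν *ᵥ w) - 2 * δ ^ 2 * nsq w) := by
        rw [Finset.sum_sub_distrib, Finset.sum_const, Finset.card_univ, Fintype.card_fin, nsmul_eq_mul]; ring
    _ ≤ ∑ ν, (star (fdiff (fine n M) (n : ℂ) ν *ᵥ wmul n M (wt n M δ ρ) w)
          ⬝ᵥ (fdiff (fine n M) (n : ℂ) ν *ᵥ wmul n M (wt n M (-δ) ρ) w)).re := Finset.sum_le_sum fun ν _ => h ν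
    _ = _ := by
        refine Finset.sum_congr rfl fun ν _ => ?_
        rw [star_dotProduct_conjTranspose_mulVec]

end ConjLap

/-! ## §5 Conjugation of a matrix by the weight: the perturbation matrix and Schur's test -/

section Conj

variable (n : ℕ) [NeZero n] (M : Fin d → ℕ) [hM : ∀ μ, NeZero (M μ)]

/-- **Schur's test for a quadratic form**: row and column sums of `‖X i j‖` at most `R` give `|⟨w, Xw⟩| ≤ R‖w‖²`.
[cite: HornJohnson2013, §5.6 (Schur's test)] -/
theorem norm_form_le_of_schur (X : Matrix (Tor (fine n M) × Fin d) (Tor (fine n M) × Fin d) ℂ) {R : ℝ} (hR : 0 ≤ R)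
    (hrow : ∀ i, ∑ j, ‖X i j‖ ≤ R) (hcol : ∀ j, ∑ i, ‖X i j‖ ≤ R) (w : Tor (fine n M) × Fin d → ℂ) :
    ‖star w ⬝ᵥ (X *ᵥ w)‖ ≤ R * nsq w := by
  have h1 := Literature.Analysis.Matrix.norm_star_dotProduct_le_sqrt_mul_sqrt w (X *ᵥ w)
  have h2 := Literature.Analysis.Matrix.sum_norm_sq_mulVec_le_of_rowSum_le_of_colSum_le X hR hrow hcol w
  have h3 : Real.sqrt (∑ i, ‖(X *ᵥ w) i‖ ^ 2) ≤ R * Real.sqrt (∑ i, ‖w i‖ ^ 2) := by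
    calc Real.sqrt (∑ i, ‖(X *ᵥ w) i‖ ^ 2) ≤ Real.sqrt (R * R * ∑ k, ‖w k‖ ^ 2) := Real.sqrt_le_sqrt h2
      _ = R * Real.sqrt (∑ i, ‖w i‖ ^ 2) := by
          rw [Real.sqrt_mul (mul_nonneg hR hR), Real.sqrt_mul_self hR]
  have hs := Real.sqrt_nonneg (∑ i, ‖w i‖ ^ 2)
  calc ‖star w ⬝ᵥ (X *ᵥ w)‖ ≤ Real.sqrt (∑ i, ‖w i‖ ^ 2) * Real.sqrt (∑ i, ‖(X *ᵥ w) i‖ ^ 2) := h1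
    _ ≤ Real.sqrt (∑ i, ‖w i‖ ^ 2) * (R * Real.sqrt (∑ i, ‖w i‖ ^ 2)) := mul_le_mul_of_nonneg_left h3 hs
    _ = R * nsq w := by
        unfold nsq
        rw [← mul_assoc, mul_comm (Real.sqrt _) R, mul_assoc, Real.mul_self_sqrt (Finset.sum_nonneg fun i _ => by positivity)]

/-- the Schur bound in `√·√` form: `|⟨u, Xw⟩| ≤ R·‖u‖·‖w‖`. [cite: HornJohnson2013, §5.6 (Schur's test)] -/
theorem norm_form_le_of_schur' (X : Matrix (Tor (fine n M) × Fin d) (Tor (fine n M) × Fin d) ℂ) {R : ℝ} (hR : 0 ≤ R)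
    (hrow : ∀ i, ∑ j, ‖X i j‖ ≤ R) (hcol : ∀ j, ∑ i, ‖X i j‖ ≤ R) (u w : Tor (fine n M) × Fin d → ℂ) :
    ‖star u ⬝ᵥ (X *ᵥ w)‖ ≤ R * Real.sqrt (nsq u) * Real.sqrt (nsq w) := by
  have h1 := Literature.Analysis.Matrix.norm_star_dotProduct_le_sqrt_mul_sqrt u (X *ᵥ w)
  have h2 := Literature.Analysis.Matrix.sum_norm_sq_mulVec_le_of_rowSum_le_of_colSum_le X hR hrow hcol w
  have h3 : Real.sqrt (∑ i, ‖(X *ᵥ w) i‖ ^ 2) ≤ R * Real.sqrt (∑ i, ‖w i‖ ^ 2) := by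
    calc Real.sqrt (∑ i, ‖(X *ᵥ w) i‖ ^ 2) ≤ Real.sqrt (R * R * ∑ k, ‖w k‖ ^ 2) := Real.sqrt_le_sqrt h2
      _ = R * Real.sqrt (∑ i, ‖w i‖ ^ 2) := by
          rw [Real.sqrt_mul (mul_nonneg hR hR), Real.sqrt_mul_self hR]
  have hs := Real.sqrt_nonneg (∑ i, ‖u i‖ ^ 2)
  calc ‖star u ⬝ᵥ (X *ᵥ w)‖ ≤ Real.sqrt (∑ i, ‖u i‖ ^ 2) * Real.sqrt (∑ i, ‖(X *ᵥ w) i‖ ^ 2) := h1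
    _ ≤ Real.sqrt (∑ i, ‖u i‖ ^ 2) * (R * Real.sqrt (∑ i, ‖w i‖ ^ 2)) := mul_le_mul_of_nonneg_left h3 hs
    _ = R * Real.sqrt (nsq u) * Real.sqrt (nsq w) := by unfold nsq; ring

/-- the PERTURBATION MATRIX of the conjugation `E X E⁻¹ − X`: entries `X(i,j)·(E(i)/E(j) − 1)`, `E = e^{δρ}`.
[cite: Balaban1984PropagatorsI, p.36 (e^{−⟨q,x⟩}Δ_a e^{⟨q,x⟩} − Δ_a)] -/
def pertW (δ : ℝ) (ρ : Tor (fine n M) → ℝ) (X : Matrix (Tor (fine n M) × Fin d) (Tor (fine n M) × Fin d) ℂ) :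
    Matrix (Tor (fine n M) × Fin d) (Tor (fine n M) × Fin d) ℂ :=
  Matrix.of fun i j => X i j * ((wt n M δ ρ i.1 * wt n M (-δ) ρ j.1 - 1 : ℝ) : ℂ)

/-- **THE CONJUGATION IDENTITY**: `⟨Ew, X(E⁻¹w)⟩ = ⟨w, Xw⟩ + ⟨w, (EXE⁻¹ − X)w⟩`.
[cite: Balaban1984PropagatorsI, p.36 (e^{−⟨q,x⟩}Δ_a e^{⟨q,x⟩} − Δ_a)] -/
theorem conj_form_eq (δ : ℝ) (ρ : Tor (fine n M) → ℝ) (X : Matrix (Tor (fine n M) × Fin d) (Tor (fine n M) × Fin d) ℂ)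
    (w : Tor (fine n M) × Fin d → ℂ) :
    star (wmul n M (wt n M δ ρ) w) ⬝ᵥ (X *ᵥ wmul n M (wt n M (-δ) ρ) w)
      = star w ⬝ᵥ (X *ᵥ w) + star w ⬝ᵥ (pertW n M δ ρ X *ᵥ w) := by
  simp only [dotProduct, Matrix.mulVec, Pi.star_apply, wmul_apply, pertW, Matrix.of_apply, Finset.mul_sum,
    ← Finset.sum_add_distrib]
  refine Finset.sum_congr rfl fun i _ => Finset.sum_congr rfl fun j _ => ?_
  rw [star_mul', Complex.star_def, Complex.conj_ofReal]
  push_cast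
  ring

omit [NeZero n] hM in
/-- the entries of the perturbation: `‖(EXE⁻¹ − X)(i,j)‖ ≤ ‖X(i,j)‖·(e^{|δ|·|x_i − x_j|} − 1)` for `ρ` 1-Lipschitz.
[cite: Balaban1984PropagatorsI, p.36 (q sufficiently small)] -/
theorem norm_pertW_le {ρ : Tor (fine n M) → ℝ} (hρ : ∀ x x', |ρ x - ρ x'| ≤ distU n M x x') (δ : ℝ)
    (X : Matrix (Tor (fine n M) × Fin d) (Tor (fine n M) × Fin d) ℂ) (i j : Tor (fine n M) × Fin d) :
    ‖pertW n M δ ρ X i j‖ ≤ ‖X i j‖ * (Real.exp (|δ| * distU n M i.1 j.1) - 1) := by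
  rw [pertW, Matrix.of_apply, norm_mul, Complex.norm_real, Real.norm_eq_abs]
  refine mul_le_mul_of_nonneg_left ?_ (norm_nonneg _)
  have h1 : wt n M δ ρ i.1 * wt n M (-δ) ρ j.1 = Real.exp (δ * (ρ i.1 - ρ j.1)) := by
    rw [wt, wt, ← Real.exp_add]; ring_nf
  rw [h1]
  refine (abs_exp_sub_one_le_exp_abs_sub_one _).trans ?_
  have h2 : |δ * (ρ i.1 - ρ j.1)| ≤ |δ| * distU n M i.1 j.1 := by
    rw [abs_mul]; exact mul_le_mul_of_nonneg_left (hρ _ _) (abs_nonneg δ)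
  linarith [Real.exp_le_exp.mpr h2]

end Conj

/-! ## §6 The conjugated averaging operator `Q*Q` -/

section ConjQ

variable (n : ℕ) [NeZero n] (M : Fin d → ℕ) [hM : ∀ μ, NeZero (M μ)]

omit [NeZero n] in
/-- the entries of `Q*Q = η^{-d}QᴴQ`: `(Q*Q)(i,j) = n^d Σ_b q(b;i)q(b;j)` (real, nonnegative).
[cite: Balaban1984PropagatorsI, (1.18) p.20 (kernel lemma; r02's `qent`)] -/
theorem QQ_apply (i j : Tor (fine n M) × Fin d) :
    (QvAdj n M * QvOp n M) i j = (((n : ℝ) ^ d * ∑ b, qent n M b i * qent n M b j : ℝ) : ℂ) := by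
  rw [QvAdj, Matrix.smul_mul, Matrix.smul_apply, Matrix.mul_apply, smul_eq_mul]
  simp only [Matrix.conjTranspose_apply, QvOp_eq_qent, Complex.star_def, Complex.conj_ofReal]
  push_cast
  rfl

omit [NeZero n] hM in
/-- `q ≥ 0`. [cite: Balaban1984PropagatorsI, (1.18) p.20] -/
theorem qent_nonneg' (b : Tor M × Fin d) (i : Tor (fine n M) × Fin d) : 0 ≤ qent n M b i := by
  unfold qent
  split_ifs
  · exact Finset.sum_nonneg fun _ _ => Finset.sum_nonneg fun _ _ => by positivity
  · exact le_rfl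

omit [NeZero n] in
/-- `‖(Q*Q)(i,j)‖ = n^d Σ_b q(b;i)q(b;j)`. [cite: Balaban1984PropagatorsI, (1.18) p.20] -/
theorem norm_QQ_apply (i j : Tor (fine n M) × Fin d) :
    ‖(QvAdj n M * QvOp n M) i j‖ = (n : ℝ) ^ d * ∑ b, qent n M b i * qent n M b j := by
  rw [QQ_apply, Complex.norm_real, Real.norm_of_nonneg]
  exact mul_nonneg (by positivity)
    (Finset.sum_nonneg fun b _ => mul_nonneg (qent_nonneg' n M b i) (qent_nonneg' n M b j))

/-- ROW SUMS `Σ_j ‖(Q*Q)(i,j)‖ = 1`. [cite: Balaban1984PropagatorsI, (1.18) p.20 (r02's `qent_rowsum`/`qent_colsum`)] -/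
theorem QQ_rowsum (i : Tor (fine n M) × Fin d) : ∑ j, ‖(QvAdj n M * QvOp n M) i j‖ = 1 := by
  have hn : (n : ℝ) ≠ 0 := Nat.cast_ne_zero.mpr (NeZero.ne n)
  simp only [norm_QQ_apply]
  rw [← Finset.mul_sum, Finset.sum_comm]
  simp only [← Finset.mul_sum, qent_rowsum, mul_one]
  rw [qent_colsum]
  field_simp

/-- COLUMN SUMS `Σ_i ‖(Q*Q)(i,j)‖ = 1` (symmetry). [cite: Balaban1984PropagatorsI, (1.18) p.20] -/
theorem QQ_colsum (j : Tor (fine n M) × Fin d) : ∑ i, ‖(QvAdj n M * QvOp n M) i j‖ = 1 := by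
  have h : ∀ i, ‖(QvAdj n M * QvOp n M) i j‖ = ‖(QvAdj n M * QvOp n M) j i‖ := by
    intro i
    rw [norm_QQ_apply, norm_QQ_apply]
    congr 1
    exact Finset.sum_congr rfl fun b _ => mul_comm _ _
  simp only [h]
  exact QQ_rowsum n M j

/-- the averaging segments stay within two units of the block corner: `q(b; i) ≠ 0 ⇒ |x_i − n·b| ≤ 2`.
[cite: Balaban1984PropagatorsI, (1.18) p.20 (x ∈ B^k(b₋), the contour [x, x(b)])] -/
theorem distU_le_two_of_qent_ne_zero {b : Tor M × Fin d} {i : Tor (fine n M) × Fin d} (h : qent n M b i ≠ 0) :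
    distU n M i.1 (toFine n M b.1) ≤ 2 := by
  have hn : (0 : ℝ) < n := by exact_mod_cast Nat.pos_of_ne_zero (NeZero.ne n)
  unfold qent at h
  split_ifs at h with hμ
  · obtain ⟨j, -, hj⟩ := Finset.exists_ne_zero_of_sum_ne_zero h
    obtain ⟨t, -, ht⟩ := Finset.exists_ne_zero_of_sum_ne_zero hj
    have hx : i.1 = bpt n M b.1 j + tstep (fine n M) b.2 t := by
      by_contra hne; exact ht (if_neg hne)
    rw [distU_eq_distSite_div, div_le_iff₀ hn]
    unfold distSite
    have hc : ∀ ν, (((i.1 ν - toFine n M b.1 ν).valMinAbs).natAbs : ℕ) ≤ 2 * n := by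
      intro ν
      have e : i.1 ν - toFine n M b.1 ν = (((j ν : ℕ) + (if ν = b.2 then (t : ℕ) else 0) : ℕ) : ZMod (fine n M ν)) := by
        rw [hx, Pi.add_apply, B5Blocks16.bpt_eq_natCast, toFine, tstep]
        push_cast
        split_ifs
        · simp; ring
        · simp
      rw [e]
      refine (natAbs_valMinAbs_natCast_le _ _).trans ?_
      have h1 : (j ν : ℕ) < n := (j ν).is_lt
      have h2 : (t : ℕ) < n := t.is_lt
      split_ifs <;> omega
    have hsup : (Finset.univ.sup fun ν => ((i.1 ν - toFine n M b.1 ν).valMinAbs).natAbs) ≤ 2 * n :=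
      Finset.sup_le fun ν _ => hc ν
    calc ((Finset.univ.sup fun ν => ((i.1 ν - toFine n M b.1 ν).valMinAbs).natAbs : ℕ) : ℝ) ≤ ((2 * n : ℕ) : ℝ) := by
          exact_mod_cast hsup
      _ = 2 * (n : ℝ) := by push_cast; ring
  · exact absurd rfl h

/-- the support of `Q*Q`: `(Q*Q)(i,j) ≠ 0 ⇒ |x_i − x_j| ≤ 4`. [cite: Balaban1984PropagatorsI, (1.18) p.20] -/
theorem distU_le_four_of_QQ_ne_zero {i j : Tor (fine n M) × Fin d} (h : (QvAdj n M * QvOp n M) i j ≠ 0) :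
    distU n M i.1 j.1 ≤ 4 := by
  rw [QQ_apply, Complex.ofReal_ne_zero] at h
  have h' := right_ne_zero_of_mul h
  obtain ⟨b, -, hb⟩ := Finset.exists_ne_zero_of_sum_ne_zero h'
  have hi : qent n M b i ≠ 0 := left_ne_zero_of_mul hb
  have hj : qent n M b j ≠ 0 := right_ne_zero_of_mul hb
  have h1 := distU_le_two_of_qent_ne_zero n M hi
  have h2 := distU_le_two_of_qent_ne_zero n M hj
  rw [distU_comm] at h2
  have := distU_triangle n M i.1 (toFine n M b.1) j.1
  linarith

/-- **CONJUGATED AVERAGING**: `|⟨Ew, Q*Q(E⁻¹w)⟩ − ⟨w, Q*Qw⟩| ≤ (e^{4|δ|} − 1)‖w‖²`.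
[cite: Balaban1984PropagatorsI, p.36 («small perturbation»), (1.18) p.20; proof ours] -/
theorem conjQQ_sub_le {ρ : Tor (fine n M) → ℝ} (hρ : ∀ x x', |ρ x - ρ x'| ≤ distU n M x x') (δ : ℝ)
    (w : Tor (fine n M) × Fin d → ℂ) :
    ‖star (wmul n M (wt n M δ ρ) w) ⬝ᵥ ((QvAdj n M * QvOp n M) *ᵥ wmul n M (wt n M (-δ) ρ) w)
        - star w ⬝ᵥ ((QvAdj n M * QvOp n M) *ᵥ w)‖ ≤ (Real.exp (4 * |δ|) - 1) * nsq w := by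
  rw [conj_form_eq, add_sub_cancel_left]
  have hR : 0 ≤ Real.exp (4 * |δ|) - 1 := by
    have : 0 ≤ 4 * |δ| := by positivity
    linarith [Real.add_one_le_exp (4 * |δ|)]
  have hent : ∀ i j, ‖pertW n M δ ρ (QvAdj n M * QvOp n M) i j‖
      ≤ (Real.exp (4 * |δ|) - 1) * ‖(QvAdj n M * QvOp n M) i j‖ := by
    intro i j
    by_cases h0 : (QvAdj n M * QvOp n M) i j = 0
    · simp [pertW, h0]
    · refine (norm_pertW_le n M hρ δ _ i j).trans ?_
      rw [mul_comm]
      refine mul_le_mul_of_nonneg_right ?_ (norm_nonneg _)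
      have h4 := distU_le_four_of_QQ_ne_zero n M h0
      have : |δ| * distU n M i.1 j.1 ≤ 4 * |δ| := by nlinarith [abs_nonneg δ]
      linarith [Real.exp_le_exp.mpr this]
  refine norm_form_le_of_schur n M _ hR (fun i => ?_) (fun j => ?_) w
  · calc ∑ j, ‖pertW n M δ ρ (QvAdj n M * QvOp n M) i j‖
        ≤ ∑ j, (Real.exp (4 * |δ|) - 1) * ‖(QvAdj n M * QvOp n M) i j‖ := Finset.sum_le_sum fun j _ => hent i j
      _ = Real.exp (4 * |δ|) - 1 := by rw [← Finset.mul_sum, QQ_rowsum, mul_one]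
  · calc ∑ i, ‖pertW n M δ ρ (QvAdj n M * QvOp n M) i j‖
        ≤ ∑ i, (Real.exp (4 * |δ|) - 1) * ‖(QvAdj n M * QvOp n M) i j‖ := Finset.sum_le_sum fun i _ => hent i j
      _ = Real.exp (4 * |δ|) - 1 := by rw [← Finset.mul_sum, QQ_colsum, mul_one]

end ConjQ

end

end Literature.MathematicalPhysics.QuantumFieldTheory.Balaban1983to89.B5CombesThomasLattice
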